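import Literature.AlgebraicGeometry.ModuliOfAbelianVarieties.Lan2013.Sec34GroupKLDuality
import Mathlib.AlgebraicGeometry.Morphisms.Proper
import Mathlib.AlgebraicGeometry.PullbackCarrier
import HarnessLib

/-!
# [Lan2013] §3.4.1 — companion proofs (`…Holds`) for `Sec34GroupKLDuality.lean`: the finite part, display (3.4.1.2)

[cite: Lan2013PELCompactifications, §3.4.1 (3.4.1.2) (p. 168)]
Squad-TS companion (RULING TS-1: theorems only, no new definition, no new named fact) discharging the two closed facts of
display (3.4.1.2) of ★ `Sec34GroupKLDuality` («we verify immediately» in print): `Lan2013_3412` — for a closed immersion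
`j : X₁ → X` over `S = Spec(R)` the finite parts satisfy `X₁^f = j⁻¹(X^f)` — and `Lan2013_3412_subgroup` — the `T`-points of a
group scheme `H` landing in the finite part `H^f` form a subgroup of `H(T)`.

The engine is one topological lemma about the typed notion ★ `IsFinitePart X U` over a LOCAL base `S = Spec(R)`
(`IsFinitePart.range_subset_of_isFinite`): every `S`-morphism `Y → X` from a scheme `Y` FINITE over `S` lands inside `U`.
Proof: `Y` is quasi-compact, so every `y ∈ Y` specialises to a closed point `y₀` (`IsClosed.exists_closed_singleton`); `Y → S` is a
closed map, so `y₀` lies over the closed point of `S`, hence its image lies in `U` (the third clause of `IsFinitePart`: points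
outside `U` avoid the closed fibre); the image of `y` specialises to the image of `y₀`, and `U` is open.  From it: two finite
parts coincide (`IsFinitePart.eq`), the preimage of a finite part under a closed immersion is a finite part
(`IsFinitePart.preimage`), and the unit, products and inverses of points landing in `U` land in `U` (the unit section
`S → H`, the composite `U ×_S U → H ×_S H → H` and `U → H → H` (inversion) are `S`-morphisms from schemes finite over `S`).
The quasi-finiteness, separatedness and Henselian hypotheses of the two facts are carried and not used: the typed identities
hold over any local base (in print they serve the EXISTENCE of the finite part, (3.4.1.1) = ★ `Lan2013_3411_finitePart`, which
is not discharged here).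
-/

noncomputable section

open CategoryTheory CategoryTheory.Limits AlgebraicGeometry MonoidalCategory CartesianMonoidalCategory
open TopologicalSpace

namespace Literature.AlgebraicGeometry.ModuliOfAbelianVarieties.Lan2013.Sec34GroupKLDuality

open scoped MonObj

universe u

section FinitePart

variable {R : Type u} [CommRing R] [IsLocalRing R] {X : Over (Spec (.of R))} {U : X.left.Opens}

/-- **The finite part absorbs everything finite over the local base.**  If `U ⊂ X` is a finite part of `X → S = Spec(R)`
(★ `IsFinitePart`, `R` local) and `f : Y → X` is a morphism with `Y → S` finite, then `f(Y) ⊆ U`: a point `y` specialises to a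
closed point `y₀` of the quasi-compact `Y`, which lies over the closed point of `S` (`Y → S` is closed), so `f(y₀) ∈ U`; and
`f(y) ⤳ f(y₀)` with `U` open. [cite: Lan2013PELCompactifications, §3.4.1 (3.4.1.1) (p. 168)] -/
theorem IsFinitePart.range_subset_of_isFinite (hU : IsFinitePart X U) {Y : Scheme.{u}} (f : Y ⟶ X.left)
    [IsFinite (f ≫ X.hom)] : Set.range f.base ⊆ (U : Set X.left) := by
  rintro _ ⟨y, rfl⟩
  haveI : CompactSpace Y := QuasiCompact.compactSpace_of_compactSpace (f ≫ X.hom)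
  obtain ⟨y₀, hy₀, hcl⟩ :=
    (isClosed_closure (s := ({y} : Set Y))).exists_closed_singleton ⟨y, subset_closure rfl⟩
  have hsp : y ⤳ y₀ := specializes_iff_mem_closure.mpr hy₀
  -- the image of the closed point `y₀` in `S = Spec R` is a closed point, i.e. the closed point
  have h1 : IsClosed ({(f ≫ X.hom).base y₀} : Set (PrimeSpectrum R)) := by
    have h := (f ≫ X.hom).isClosedMap _ hcl
    rw [Set.image_singleton] at h
    exact h
  have h2 : (f ≫ X.hom).base y₀ = IsLocalRing.closedPoint R :=
    (Set.mem_singleton_iff.mp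
      ((IsLocalRing.specializes_closedPoint ((f ≫ X.hom).base y₀)).mem_closed h1 (Set.mem_singleton _))).symm
  have h5 : f.base y₀ ∈ (U : Set X.left) := by
    by_contra h6
    exact hU.2.2.1 (f.base y₀) h6 h2
  exact (hsp.map f.continuous).mem_open U.isOpen h5

/-- A finite part is contained in any other finite part (the clopen `U` is a closed subscheme of `X` finite over `S`, so the
maximality clause of the other applies); hence **the finite part is unique** (`IsFinitePart.eq`).
[cite: Lan2013PELCompactifications, §3.4.1 (3.4.1.1) (p. 168)] -/
theorem IsFinitePart.le (hU : IsFinitePart X U) {V : X.left.Opens} (hV : IsFinitePart X V) : U ≤ V := by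
  intro x hx
  haveI : IsClosedImmersion U.ι :=
    IsClosedImmersion.of_isPreimmersion _ (by rw [Scheme.Opens.range_ι]; exact hU.1)
  haveI : IsFinite (U.ι ≫ X.hom) := hU.2.1
  have h := hV.2.2.2 _ U.ι inferInstance inferInstance
  rw [Scheme.Opens.range_ι] at h
  exact h hx

/-- **Uniqueness of the finite part**: two finite parts of `X → S` coincide. [cite: Lan2013PELCompactifications, §3.4.1 (3.4.1.1) (p. 168)] -/
theorem IsFinitePart.eq (hU : IsFinitePart X U) {V : X.left.Opens} (hV : IsFinitePart X V) : U = V :=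
  le_antisymm (hU.le hV) (hV.le hU)

/-- **The preimage of the finite part under a closed immersion `j : X₁ → X` over `S` is a finite part of `X₁`**: it is
clopen; `j⁻¹(U) → S` factors as the closed immersion `j|_U : j⁻¹(U) → U` followed by the finite `U → S`; points off `j⁻¹(U)` map
off `U`, hence off the closed fibre; a closed subscheme `Z ⊂ X₁` finite over `S` is a closed subscheme of `X` through `j`, so it
lies in `U`. [cite: Lan2013PELCompactifications, §3.4.1 (3.4.1.2) (p. 168)] -/
theorem IsFinitePart.preimage (hU : IsFinitePart X U) {X₁ : Over (Spec (.of R))} (j : X₁ ⟶ X)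
    [IsClosedImmersion j.left] : IsFinitePart X₁ (j.left ⁻¹ᵁ U) := by
  refine ⟨hU.1.preimage j.left.continuous, ?_, ?_, ?_⟩
  · have e : (j.left ⁻¹ᵁ U).ι ≫ X₁.hom = (j.left ∣_ U) ≫ U.ι ≫ X.hom := by
      rw [← Over.w j, morphismRestrict_ι_assoc]
    haveI : IsFinite (U.ι ≫ X.hom) := hU.2.1
    rw [e]
    infer_instance
  · intro x hx
    have e : X₁.hom.base x = X.hom.base (j.left.base x) := by
      rw [← Over.w j]
      rfl
    rw [e]
    exact hU.2.2.1 (j.left.base x) hx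
  · intro Z i hi hfin
    haveI : IsFinite ((i ≫ j.left) ≫ X.hom) := by
      rw [Category.assoc, Over.w j]
      exact hfin
    have h := hU.2.2.2 Z (i ≫ j.left) inferInstance inferInstance
    rintro _ ⟨z, rfl⟩
    exact h ⟨z, rfl⟩

end FinitePart

/-- **(3.4.1.2), DISCHARGED: `H₁^f = H₁ ∩ H^f`** — for a closed immersion `j : X₁ → X` over `S = Spec(R)` and the finite parts
`U = X^f`, `U₁ = X₁^f`, one has `U₁ = j⁻¹(U)`: `j⁻¹(U)` is a finite part of `X₁` (`IsFinitePart.preimage`) and the finite part is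
unique (`IsFinitePart.eq`).  (The quasi-finite ∕ separated ∕ Henselian hypotheses are not used.)
[cite: Lan2013PELCompactifications, §3.4.1 (3.4.1.2) (p. 168)] -/
theorem Lan2013_3412_holds : Lan2013_3412.{u} := by
  intro R _ _ X X₁ j _ _ _ _ U U₁ hU hU₁
  exact hU₁.eq (hU.preimage j)

/-- **(3.4.1.2), the subgroup clause, DISCHARGED: «`H^f` is an (open and closed) subgroup scheme of `H`»** — for every
`S`-scheme `T`, the `T`-points `g : T → H` with `g(T) ⊆ U = H^f` form a subgroup of `H(T)`.  Unit: `1 = (T → S) ≫ e_H` and the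
unit section `e_H : S → H` is finite over `S` (`e_H ≫ (H → S) = 𝟙`), so it lands in `U`.  Product: `g · h = (g, h) ≫ m_H`, the
point `(g, h)(t)` of `H ×_S H` has both projections in `U`, so it is the image of a point of `U ×_S U`
(`Scheme.Pullback.range_map`), and `U ×_S U → H ×_S H → H` lands in `U` because `U ×_S U` is finite over `S`.  Inverse:
`g⁻¹ = g ≫ [-1]_H`, and `U ↪ H → H`, `[-1]_H` being over `S`, is finite over `S`.  Each time by
`IsFinitePart.range_subset_of_isFinite`.  (The quasi-finite ∕ separated ∕ Henselian hypotheses are not used.)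
[cite: Lan2013PELCompactifications, §3.4.1 (3.4.1.2) (p. 168)] -/
theorem Lan2013_3412_subgroup_holds : Lan2013_3412_subgroup.{u} := by
  intro R _ _ H _ U _ _ _ hU T
  refine ⟨{ carrier := {g | Set.range g.left.base ⊆ (U : Set H.left)}
            mul_mem' := ?_, one_mem' := ?_, inv_mem' := ?_ }, fun g => Iff.rfl⟩
  · -- products
    intro g h hg hh
    simp only [Set.mem_setOf_eq] at hg hh ⊢
    rintro _ ⟨t, rfl⟩
    haveI : IsFinite (U.ι ≫ H.hom) := hU.2.1
    -- the comparison `U ×_S U → H ×_S H` and the composite `U ×_S U → H ×_S H → H`, a morphism over `S`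
    let c : pullback (U.ι ≫ H.hom) (U.ι ≫ H.hom) ⟶ pullback H.hom H.hom :=
      pullback.map (U.ι ≫ H.hom) (U.ι ≫ H.hom) H.hom H.hom U.ι U.ι (𝟙 _) (Category.comp_id _) (Category.comp_id _)
    let f : pullback (U.ι ≫ H.hom) (U.ι ≫ H.hom) ⟶ H.left := c ≫ μ[H].left
    have hc₁ : c ≫ pullback.fst H.hom H.hom = pullback.fst _ _ ≫ U.ι := pullback.lift_fst _ _ _
    have ef : f ≫ H.hom = pullback.fst (U.ι ≫ H.hom) (U.ι ≫ H.hom) ≫ U.ι ≫ H.hom :=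
      calc f ≫ H.hom = c ≫ (μ[H].left ≫ H.hom) := Category.assoc _ _ _
      _ = c ≫ (pullback.fst H.hom H.hom ≫ H.hom) := congrArg (c ≫ ·) (Over.w μ[H])
      _ = (c ≫ pullback.fst H.hom H.hom) ≫ H.hom := (Category.assoc _ _ _).symm
      _ = (pullback.fst _ _ ≫ U.ι) ≫ H.hom := by rw [hc₁]
      _ = pullback.fst _ _ ≫ U.ι ≫ H.hom := Category.assoc _ _ _
    haveI : IsFinite (f ≫ H.hom) := by
      rw [ef]
      infer_instance
    have hsub := hU.range_subset_of_isFinite f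
    -- the point `(g, h)(t)` of `H ×_S H` has both projections in `U`, so it comes from `U ×_S U`
    obtain ⟨x, hx⟩ : g.left.base t ∈ Set.range U.ι.base := by
      rw [Scheme.Opens.range_ι]
      exact hg ⟨t, rfl⟩
    obtain ⟨y, hy⟩ : h.left.base t ∈ Set.range U.ι.base := by
      rw [Scheme.Opens.range_ι]
      exact hh ⟨t, rfl⟩
    have e₁ : (lift g h).left ≫ pullback.fst H.hom H.hom = g.left := by
      change (lift g h ≫ fst H H).left = g.left
      rw [lift_fst]
    have e₂ : (lift g h).left ≫ pullback.snd H.hom H.hom = h.left := by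
      change (lift g h ≫ snd H H).left = h.left
      rw [lift_snd]
    obtain ⟨q, hq⟩ : (lift g h).left.base t ∈ Set.range c.base := by
      rw [Scheme.Pullback.range_map]
      refine ⟨⟨x, ?_⟩, ⟨y, ?_⟩⟩
      · change U.ι.base x = ((lift g h).left ≫ pullback.fst H.hom H.hom).base t
        rw [e₁]
        exact hx
      · change U.ι.base y = ((lift g h).left ≫ pullback.snd H.hom H.hom).base t
        rw [e₂]
        exact hy
    have e : (g * h).left.base t = f.base q := by
      rw [Hom.mul_def, Over.comp_left, Scheme.Hom.comp_base]
      change μ[H].left.base ((lift g h).left.base t) = μ[H].left.base (c.base q)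
      rw [hq]
    rw [e]
    exact hsub ⟨q, rfl⟩
  · -- the unit
    simp only [Set.mem_setOf_eq]
    haveI : IsFinite (η[H].left ≫ H.hom) := by
      rw [Over.w]
      change IsFinite (𝟙 _)
      infer_instance
    have hsub := hU.range_subset_of_isFinite η[H].left
    rintro _ ⟨t, rfl⟩
    rw [Hom.one_def, Over.comp_left, Scheme.Hom.comp_base]
    exact hsub ⟨_, rfl⟩
  · -- inverses
    intro g hg
    simp only [Set.mem_setOf_eq] at hg ⊢
    haveI : IsFinite (U.ι ≫ H.hom) := hU.2.1
    haveI : IsFinite ((U.ι ≫ ι[H].left) ≫ H.hom) := by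
      rw [Category.assoc, Over.w]
      infer_instance
    have hsub := hU.range_subset_of_isFinite (U.ι ≫ ι[H].left)
    rintro _ ⟨t, rfl⟩
    obtain ⟨x, hx⟩ := hg ⟨t, rfl⟩ |> fun m => (show g.left.base t ∈ Set.range U.ι.base by
      rw [Scheme.Opens.range_ι]; exact m)
    rw [Hom.inv_def, Over.comp_left, Scheme.Hom.comp_base]
    change ι[H].left.base (g.left.base t) ∈ (U : Set H.left)
    rw [← hx]
    exact hsub ⟨x, rfl⟩

end Literature.AlgebraicGeometry.ModuliOfAbelianVarieties.Lan2013.Sec34GroupKLDuality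

end
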